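import Summits.QuantumFields.BalabanUV.T4Continuum.Support.TermwiseHeterogeneousWindow
import Summits.QuantumFields.BalabanUV.T4Continuum.Support.NE7PairwiseTower

/-!
# NE7PairwiseFixedWindowCensus — row NE7 (node U5), route «PAIR-CAUCHY» (R-P2, 1-bis): THE FIXED-DEPTH CENSUS — road
# P1's level-graded one-step majorant (`TermwiseHeterogeneous` §3–§4, `TermwiseHeterogeneousWindow` §6) read at a
# K-INDEPENDENT window depth `w`: NULL in `K` for EVERY age profile, with NO census ∕ density ∕ summability condition —
# the action-kind face of «the double limit needs no summability device»

Cell `pub-balaban`, rung (B)+1 sub-cell t4, lineage `b2b-balaban-t4-ne7-p2` (CRUX PROVER NE7 #2 under the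
coordinator ruling «YM redirect», 2026-08-21; generation 55; texts: `HOME/t4/b2b-balaban-t4-ne7-p2/g55/ROUTE2-NE7-P2.md`
v1.10 §2 NODE S ∕ NODE W♭ («PAIR-CAUCHY takes the window depth as a FREE, K-INDEPENDENT parameter `w` and closes by a
DOUBLE LIMIT») and §13, and the headers of road P1's `Support/TermwiseHeterogeneous` (§4 VERDICT: with a `K`-uniform
age profile over ALL ages the level-graded action-kind majorant is summable iff the roughness-weighted age profile is —
and Bałaban's d = 4 profile `f(a)·L^{4a} ≍ L^{4a}e^{−p₀(g(a))}` is NOT) and `Support/TermwiseHeterogeneousWindow` (§6: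
under the LOGARITHMIC window `jlogOf Cw K` the majorant is summable for every `0 < θ < 1 ≤ Λ`; opened to all ages it is
`≥ Λ^K` — «the window is load-bearing»).  HONEST FRAMING (page 1): FIXED FINITE T⁴, rung (B)+1 = existence AND
uniqueness of the `ε = L^{−K} → 0` limit of unit-scale averaged expectations, CONDITIONAL on BetaPertH and the nine
spine estimates (0/9 proved); NOT infinite volume, NOT a mass gap, NOT the Clay problem.  NE7 is NOT PRINTED in
[Balaban1984PropagatorsI]–[Balaban1989LargeFieldII] and NOT proved here.  Everything below is [folklore] real-number
bookkeeping over road P1's `windowSum` ∕ `sum_range_le_windowSum`; no definition, no cite tag, nothing printed asserted,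
no `sorry`.

WHY.  On route R-P2 the good class at window depth `w` carries rough (large-field ∕ boundary) structure only at AGES
`< w` (the bad class `⋃_{a ∈ [w, K]} LF a` — `NE7PairwiseDeepBadClass`, `NE7PairwiseFibre` — takes every history with
a rough degree of freedom at an age `≥ w`), and the per-sequence good clause ((E♭-inst) (i)) needs its remainder
`δ w ν K` NULL in `K` at FIXED `w`, nothing more (`NE7PairwiseOffsetEndSeq`).  Road P1's census of the term-wise ACTION
kind (the hardest kind of its ledger) bounds the one-step sandwich error at cutoff `K` by the level-graded majorant
`δ K ≤ C·Σ_{j ≤ K} μ_K(j)·θ^j` (`θ = L^{−2}`; level shares `μ_K(j) ≤ F·Λ^{K−j}`, `Λ = L⁴`, on the levels carrying rough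
windows, `≤ 0` elsewhere).  Read at FIXED DEPTH — shares vanish at levels `j ≤ K − w`, i.e. ages `≥ w` — the majorant is
at most `C·F·windowSum θ Λ (K+1−w) K ≤ C·F·w·Λ^w·θ^{K+1−w}`: NULL in `K` for every `0 ≤ θ < 1` and EVERY `Λ ≥ 1`, with
no relation between `θ` and `Λ`, no age profile, no density statement, no summability-in-`K` device — the `w`-growth
`(Λ∕θ)^w` is harmless because `w → ∞` only AFTER `K → ∞` (p248170's double limit).  The constants `C, F` may depend on
the offset sequence `ν` (the sequence-indexed socket p261256 allows it).  For contrast: P1's consecutive currency needs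
`Summable δ`, its bad-class weight must then be summable in `K`, which forces the window to deepen with `K` (`jlogOf`) and
the rate `θ^j` to beat the window multiplicity (`TermwiseHeterogeneousWindow.summable_of_levels_logWindow`); at fixed
depth the majorant is trivially summable too (§3), but a fixed-depth bad class is not null in `K` — only the double
limit uses it.

WHAT IS PROVED ([folklore]).
§1 `card_Icc_sub_le`, **`windowSum_fixedDepth_le`** (`windowSum θ Λ (K+1−w) K ≤ w·Λ^w·θ^{K+1−w}` for `0 ≤ θ ≤ 1 ≤ Λ`,
   all `K`), **`tendsto_windowSum_fixedDepth`** (`→ 0` for `θ < 1`).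
§2 **`tendsto_zero_of_levels_fixedWindow`** (the fixed-depth twin of `summable_of_levels_logWindow`: level shares `≤ 0`
   below `K+1−w` and `≤ F·Λ^{K−j}` above ⟹ `δ → 0`), `levels_fixedWindow_le` (explicit: `δ K ≤ C·F·(w·Λ^w·θ^{K+1−w})`),
   **`tendsto_zero_of_volumeFraction_fixedWindow`** (§3's currency of `TermwiseHeterogeneous`: shares
   `f_K(j)·Λ^{K−j}` with volume fractions `≤ 1` vanishing at ages `≥ w`).
§3 `summable_of_levels_fixedWindow` (at fixed depth the majorant is even summable in `K` — recorded so that nobody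
   mistakes §2 for the gain: the gain of R-P2 is on the BAD-CLASS side, where depth `w` costs `η w`, not `η(jlogOf K)`).
§4 (v1.1, same generation; §§1–3 byte-identical to v1 p262009) THE `K`-UNIFORM ALL-AGES SPECIES — the one road P1 locates
   in the GOOD class with a profile over all ages (the coupling lag on old HEALED islands, [Balaban1988Convergent] (2.24);
   `TermwiseHeterogeneousWindow` header): `ageConv_eq_sum_range`, `exists_abs_le_of_tendsto_zero`,
   **`tendsto_ageConv_of_tendsto`** (null profile ⟹ null age convolution — Tannery, by `NE7PairwiseTower.tendsto_geomConv`),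
   **`tendsto_ageConv_iff`** (NULL IFF THE PROFILE IS NULL — the twin of P1's `summable_ageConv_iff`),
   `tendsto_zero_of_levels_allAges` (twin of `summable_of_levels`).  HONEST: for this species the ask is LOWERED (`φ → 0`
   instead of `Σ φ < ∞`), NOT removed; by P1's READING of the d = 4 large-field count (`f(a)·L^{4a} ≫ 1`, NOT a theorem)
   neither holds through this majorant, so the species stays exactly where P1 has it (island-density clause as a
   weight-half input ∕ a localised action comparison) — §2's «no condition» covers the structure of ages `< w` only.

NOT DELIVERED: that road P1's action-kind remainder for the PAIR `(K, K + ν K)` HAS the level-graded majorant shape with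
shares supported at ages `< w` on the depth-`w` good class ((E♭-inst) (i): P1's END assembled with the window depth as
a parameter instead of `jlogOf Cl K` — P1's `hBwin : RecentOnly (bfac K t τ) C.scale (jlogOf Cl K) K` is hard-wired in
all ten `Termwise*` ledgers; XL bookkeeping, not attempted), the level-graded regularity binders on the young windows
(road P1's Theorem-1 plumbing per level, both runs), rows NE7b ∕ NE7c.  NOT NE7 (spine 0/9 unchanged), NOT summit
progress.  HONEST DEPENDENCY: continuum YM on T⁴ ⇐ BetaPertH ∧ nine spine estimates (0/9 proved); BetaPertH ⇐ (D1) ∧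
(D4) ∧ CAP+tail; G-an2-4 gates asym, D1 and NE2/3/4.
-/

noncomputable section

open Finset _root_.Filter _root_.Topology
open scoped BigOperators

namespace Summit.QuantumFields.BalabanUV.T4Continuum.NE7PairwiseFixedWindowCensus

open Literature.MathematicalPhysics.QuantumFieldTheory.Balaban1983to89.T4GoodClassBudget (windowSum windowSum_nonneg)
open Summit.QuantumFields.BalabanUV.T4Continuum.TermwiseHeterogeneous (sum_range_le_windowSum)

/-! ## §1 The window sum at fixed depth -/

section WindowSum

/-- The fixed-depth window `[K+1−w, K]` has at most `w` levels. [folklore] -/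
theorem card_Icc_sub_le (w K : ℕ) : (Finset.Icc (K + 1 - w) K).card ≤ w := by
  rw [Nat.card_Icc]
  omega

/-- **THE WINDOW SUM AT FIXED DEPTH**: for `0 ≤ θ ≤ 1 ≤ Λ` and every `K`,
`windowSum θ Λ (K+1−w) K = Σ_{j ∈ [K+1−w, K]} θ^j·Λ^{K−j} ≤ w·Λ^w·θ^{K+1−w}` (at most `w` terms, each with
`θ^j ≤ θ^{K+1−w}` and `Λ^{K−j} ≤ Λ^w`). [folklore] -/
theorem windowSum_fixedDepth_le {θ Λ : ℝ} (hθ : 0 ≤ θ) (hθ1 : θ ≤ 1) (hΛ : 1 ≤ Λ) (w K : ℕ) :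
    windowSum θ Λ (K + 1 - w) K ≤ (w : ℝ) * Λ ^ w * θ ^ (K + 1 - w) := by
  unfold windowSum
  have hterm : ∀ j ∈ Finset.Icc (K + 1 - w) K, θ ^ j * Λ ^ (K - j) ≤ Λ ^ w * θ ^ (K + 1 - w) := by
    intro j hj
    obtain ⟨hj1, hj2⟩ := Finset.mem_Icc.mp hj
    rw [mul_comm]
    refine mul_le_mul (pow_le_pow_right₀ hΛ (by omega)) (pow_le_pow_of_le_one hθ hθ1 hj1)
      (pow_nonneg hθ _) (pow_nonneg (zero_le_one.trans hΛ) _)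
  calc ∑ j ∈ Finset.Icc (K + 1 - w) K, θ ^ j * Λ ^ (K - j)
      ≤ ∑ _j ∈ Finset.Icc (K + 1 - w) K, Λ ^ w * θ ^ (K + 1 - w) := Finset.sum_le_sum hterm
    _ = ((Finset.Icc (K + 1 - w) K).card : ℝ) * (Λ ^ w * θ ^ (K + 1 - w)) := by
        rw [Finset.sum_const, nsmul_eq_mul]
    _ ≤ (w : ℝ) * (Λ ^ w * θ ^ (K + 1 - w)) :=
        mul_le_mul_of_nonneg_right (by exact_mod_cast card_Icc_sub_le w K)
          (mul_nonneg (pow_nonneg (zero_le_one.trans hΛ) _) (pow_nonneg hθ _))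
    _ = (w : ℝ) * Λ ^ w * θ ^ (K + 1 - w) := by ring

/-- … hence `windowSum θ Λ (K+1−w) K → 0` as `K → ∞` at FIXED depth `w`, for every `0 ≤ θ < 1 ≤ Λ` — no relation between
`θ` and `Λ` (contrast: `TermwiseHeterogeneousWindow.not_summable_windowSum_allAges`). [folklore] -/
theorem tendsto_windowSum_fixedDepth {θ Λ : ℝ} (hθ : 0 ≤ θ) (hθ1 : θ < 1) (hΛ : 1 ≤ Λ) (w : ℕ) :
    Tendsto (fun K => windowSum θ Λ (K + 1 - w) K) atTop (𝓝 0) := by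
  have hsub : Tendsto (fun K : ℕ => K + 1 - w) atTop atTop :=
    (tendsto_sub_atTop_nat w).comp (tendsto_add_atTop_nat 1)
  have hpow : Tendsto (fun K : ℕ => θ ^ (K + 1 - w)) atTop (𝓝 0) :=
    (tendsto_pow_atTop_nhds_zero_of_lt_one hθ hθ1).comp hsub
  have hmaj : Tendsto (fun K : ℕ => (w : ℝ) * Λ ^ w * θ ^ (K + 1 - w)) atTop (𝓝 0) := by
    simpa using hpow.const_mul ((w : ℝ) * Λ ^ w)
  exact squeeze_zero (fun K => windowSum_nonneg hθ (zero_le_one.trans hΛ) _ _)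
    (fun K => windowSum_fixedDepth_le hθ hθ1.le hΛ w K) hmaj

end WindowSum

/-! ## §2 The fixed-depth census: null in `K`, no condition -/

section Census

/-- **THE FIXED-DEPTH CENSUS.**  The level-graded majorant `δ K ≤ C·Σ_{j ≤ K} μ_K(j)·θ^j` with level shares `≤ 0` at the
levels `j < K+1−w` (ages `≥ w`: the depth-`w` good class carries no rough structure there) and `≤ F·Λ^{K−j}` on the
window ⟹ `δ → 0`, for EVERY `0 ≤ θ < 1 ≤ Λ`, every `F`, every `w` — no age profile, no density, no summability device
(the fixed-depth twin of `TermwiseHeterogeneousWindow.summable_of_levels_logWindow`). [folklore] -/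
theorem tendsto_zero_of_levels_fixedWindow {δ : ℕ → ℝ} {μ : ℕ → ℕ → ℝ} {C θ Λ F : ℝ} (w : ℕ) (hC : 0 ≤ C)
    (hθ : 0 ≤ θ) (hθ1 : θ < 1) (hΛ : 1 ≤ Λ) (hδ0 : ∀ K, 0 ≤ δ K)
    (hδ : ∀ K, δ K ≤ C * ∑ j ∈ Finset.range (K + 1), μ K j * θ ^ j)
    (hold : ∀ K, ∀ j < K + 1 - w, μ K j ≤ 0)
    (hyoung : ∀ K j, K + 1 - w ≤ j → j ≤ K → μ K j ≤ F * Λ ^ (K - j)) :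
    Tendsto δ atTop (𝓝 0) := by
  have hmaj : ∀ K, δ K ≤ C * F * windowSum θ Λ (K + 1 - w) K := fun K => by
    rw [mul_assoc]
    exact (hδ K).trans (mul_le_mul_of_nonneg_left (sum_range_le_windowSum hθ (hold K) (hyoung K)) hC)
  have hlim : Tendsto (fun K => C * F * windowSum θ Λ (K + 1 - w) K) atTop (𝓝 0) := by
    simpa using (tendsto_windowSum_fixedDepth hθ hθ1 hΛ w).const_mul (C * F)
  exact squeeze_zero hδ0 hmaj hlim

/-- **THE FIXED-DEPTH CENSUS, EXPLICIT**: `δ K ≤ C·F·(w·Λ^w·θ^{K+1−w})` (`0 ≤ F`) — geometric in `K` at fixed `w`; the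
`w`-growth `(Λ∕θ)^w` is why the depth is sent to `∞` only after `K`. [folklore] -/
theorem levels_fixedWindow_le {δ : ℕ → ℝ} {μ : ℕ → ℕ → ℝ} {C θ Λ F : ℝ} (w : ℕ) (hC : 0 ≤ C) (hF : 0 ≤ F)
    (hθ : 0 ≤ θ) (hθ1 : θ ≤ 1) (hΛ : 1 ≤ Λ)
    (hδ : ∀ K, δ K ≤ C * ∑ j ∈ Finset.range (K + 1), μ K j * θ ^ j)
    (hold : ∀ K, ∀ j < K + 1 - w, μ K j ≤ 0)
    (hyoung : ∀ K j, K + 1 - w ≤ j → j ≤ K → μ K j ≤ F * Λ ^ (K - j)) (K : ℕ) :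
    δ K ≤ C * F * ((w : ℝ) * Λ ^ w * θ ^ (K + 1 - w)) := by
  calc δ K ≤ C * ∑ j ∈ Finset.range (K + 1), μ K j * θ ^ j := hδ K
    _ ≤ C * (F * windowSum θ Λ (K + 1 - w) K) :=
        mul_le_mul_of_nonneg_left (sum_range_le_windowSum hθ (hold K) (hyoung K)) hC
    _ ≤ C * (F * ((w : ℝ) * Λ ^ w * θ ^ (K + 1 - w))) :=
        mul_le_mul_of_nonneg_left (mul_le_mul_of_nonneg_left (windowSum_fixedDepth_le hθ hθ1 hΛ w K) hF) hC
    _ = _ := by ring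

/-- **THE FIXED-DEPTH CENSUS IN THE VOLUME-FRACTION CURRENCY** (`TermwiseHeterogeneous` §3): level shares
`μ_K(j) = f_K(j)·Λ^{K−j}` with volume fractions `f_K(j) ≤ 1` that VANISH at ages `≥ w` (the depth-`w` good class): the
majorant is null in `K` for every `0 ≤ θ < 1 ≤ Λ` — per term, NO density statement, NO age profile (in particular none
of the summability that `TermwiseHeterogeneous.summable_ageConv_iff` shows to FAIL for Bałaban's d = 4 profile is asked).
[folklore] -/
theorem tendsto_zero_of_volumeFraction_fixedWindow {δ : ℕ → ℝ} {f : ℕ → ℕ → ℝ} {C θ Λ : ℝ} (w : ℕ) (hC : 0 ≤ C)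
    (hθ : 0 ≤ θ) (hθ1 : θ < 1) (hΛ : 1 ≤ Λ) (hδ0 : ∀ K, 0 ≤ δ K)
    (hδ : ∀ K, δ K ≤ C * ∑ j ∈ Finset.range (K + 1), (f K j * Λ ^ (K - j)) * θ ^ j)
    (hf1 : ∀ K j, f K j ≤ 1) (hfold : ∀ K, ∀ j < K + 1 - w, f K j ≤ 0) :
    Tendsto δ atTop (𝓝 0) := by
  have hΛ0 : 0 ≤ Λ := zero_le_one.trans hΛ
  refine tendsto_zero_of_levels_fixedWindow (μ := fun K j => f K j * Λ ^ (K - j)) (F := 1) w hC hθ hθ1 hΛ hδ0 hδ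
    (fun K j hj => ?_) (fun K j _ _ => ?_)
  · exact mul_nonpos_of_nonpos_of_nonneg (hfold K j hj) (pow_nonneg hΛ0 _)
  · simpa using mul_le_mul_of_nonneg_right (hf1 K j) (pow_nonneg hΛ0 (K - j))

end Census

/-! ## §3 Record: at fixed depth the majorant is even summable in `K` (this is NOT where R-P2 gains) -/

section Record

/-- At fixed depth the majorant is dominated by a geometric sequence, hence summable in `K` as well — so road P1's
consecutive currency would ALSO hold per window; what P1 cannot afford is the fixed-depth BAD class (weight `η w`, not
null in `K`), which forces its window to deepen with `K`.  R-P2's gain is on that side (double limit), not here.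
[folklore] -/
theorem summable_of_levels_fixedWindow {δ : ℕ → ℝ} {μ : ℕ → ℕ → ℝ} {C θ Λ F : ℝ} (w : ℕ) (hC : 0 ≤ C) (hF : 0 ≤ F)
    (hθ : 0 ≤ θ) (hθ1 : θ < 1) (hΛ : 1 ≤ Λ) (hδ0 : ∀ K, 0 ≤ δ K)
    (hδ : ∀ K, δ K ≤ C * ∑ j ∈ Finset.range (K + 1), μ K j * θ ^ j)
    (hold : ∀ K, ∀ j < K + 1 - w, μ K j ≤ 0)
    (hyoung : ∀ K j, K + 1 - w ≤ j → j ≤ K → μ K j ≤ F * Λ ^ (K - j)) :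
    Summable δ := by
  -- the shifted geometric series: `K ↦ θ^{K+1−w}` is `θ^{K+1}` re-indexed by `w`
  have hpow : Summable fun K : ℕ => θ ^ (K + 1 - w) := by
    have h1 : Summable fun K : ℕ => θ ^ (K + 1) := by
      simpa [pow_succ] using (summable_geometric_of_lt_one hθ hθ1).mul_right θ
    have h2 : Summable fun K : ℕ => θ ^ (K + w + 1 - w) := by
      have e : (fun K : ℕ => θ ^ (K + w + 1 - w)) = fun K => θ ^ (K + 1) := by
        funext K
        congr 1
        omega
      rw [e]
      exact h1
    exact (summable_nat_add_iff w).1 h2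
  have hgeo : Summable fun K : ℕ => C * F * ((w : ℝ) * Λ ^ w * θ ^ (K + 1 - w)) :=
    (hpow.mul_left _).mul_left _
  exact Summable.of_nonneg_of_le hδ0 (levels_fixedWindow_le w hC hF hθ hθ1.le hΛ hδ hold hyoung) hgeo

end Record

/-! ## §4 (v1.1) The `K`-uniform ALL-AGES species in the null currency: null iff the age profile is null -/

section AllAges

open Summit.QuantumFields.BalabanUV.T4Continuum.TermwiseHeterogeneous
  (ageConv ageConv_def ageConv_nonneg le_ageConv sum_range_le_ageConv)

/-- The age convolution as a `range` sum: `ageConv φ θ K = Σ_{n ≤ K} θ^n·φ(K − n)`. [folklore] -/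
theorem ageConv_eq_sum_range (φ : ℕ → ℝ) (θ : ℝ) (K : ℕ) :
    ageConv φ θ K = ∑ n ∈ Finset.range (K + 1), θ ^ n * φ (K - n) := by
  rw [ageConv_def, ← Finset.Nat.sum_antidiagonal_swap, Finset.Nat.sum_antidiagonal_eq_sum_range_succ_mk]
  exact Finset.sum_congr rfl fun n _ => by simp [mul_comm]

/-- A nonnegative null sequence is bounded in absolute value. [folklore] -/
theorem exists_abs_le_of_tendsto_zero {φ : ℕ → ℝ} (hφ0 : ∀ a, 0 ≤ φ a) (hφ : Tendsto φ atTop (𝓝 0)) :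
    ∃ U : ℝ, ∀ a, |φ a| ≤ U := by
  have hc : Tendsto φ cofinite (𝓝 0) := by rwa [Nat.cofinite_eq_atTop]
  obtain ⟨U, hU⟩ := hc.bddAbove_range_of_cofinite
  exact ⟨U, fun a => by rw [abs_of_nonneg (hφ0 a)]; exact hU ⟨a, rfl⟩⟩

/-- **NULL PROFILE ⟹ NULL AGE CONVOLUTION** (`0 ≤ φ → 0`, `0 ≤ θ < 1`): `ageConv φ θ K = Σ_{a+j=K} φ(a)·θ^j → 0` — Tannery,
by `NE7PairwiseTower.tendsto_geomConv`.  The null-currency twin of `TermwiseHeterogeneous.summable_ageConv`. [folklore] -/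
theorem tendsto_ageConv_of_tendsto {φ : ℕ → ℝ} {θ : ℝ} (hφ0 : ∀ a, 0 ≤ φ a) (hφ : Tendsto φ atTop (𝓝 0))
    (hθ0 : 0 ≤ θ) (hθ1 : θ < 1) : Tendsto (ageConv φ θ) atTop (𝓝 0) := by
  obtain ⟨U, hU⟩ := exists_abs_le_of_tendsto_zero hφ0 hφ
  have h := NE7PairwiseTower.tendsto_geomConv hθ0 hθ1 hU hφ
  refine h.congr fun K => ?_
  rw [ageConv_eq_sum_range]

/-- **THE ALL-AGES CENSUS IN THE NULL CURRENCY: NULL IFF THE PROFILE IS NULL** (`0 ≤ φ`, `0 ≤ θ < 1`) — the twin of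
`TermwiseHeterogeneous.summable_ageConv_iff` (summable iff summable).  For a species of the good class with a `K`-UNIFORM age
profile over ALL ages (road P1's located example: the coupling lag on old HEALED islands, [Balaban1988Convergent] (2.24),
`TermwiseHeterogeneousWindow` header) route R-P2 asks `φ(a) → 0` where P1 asks `Σ_a φ(a) < ∞` — the ask is LOWERED, not
removed; §2's «no condition» is for the species supported at ages `< w` only. [folklore] -/
theorem tendsto_ageConv_iff {φ : ℕ → ℝ} {θ : ℝ} (hφ0 : ∀ a, 0 ≤ φ a) (hθ0 : 0 ≤ θ) (hθ1 : θ < 1) :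
    Tendsto (ageConv φ θ) atTop (𝓝 0) ↔ Tendsto φ atTop (𝓝 0) :=
  ⟨fun h => squeeze_zero hφ0 (le_ageConv hφ0 hθ0) h, fun h => tendsto_ageConv_of_tendsto hφ0 h hθ0 hθ1⟩

/-- **THE ALL-AGES SPECIES, COMBINED**: `δ K ≤ C·Σ_{j ≤ K} μ_K(j)·θ^j` with an IR-anchored `K`-uniform age profile
`μ_K(j) ≤ φ(K − j)`, `0 ≤ φ → 0`, `0 ≤ δ`, `0 ≤ C`, `0 ≤ θ < 1` ⟹ `δ → 0` (twin of `TermwiseHeterogeneous.summable_of_levels`).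
[folklore] -/
theorem tendsto_zero_of_levels_allAges {δ : ℕ → ℝ} {μ : ℕ → ℕ → ℝ} {φ : ℕ → ℝ} {C θ : ℝ} (hC : 0 ≤ C)
    (hθ0 : 0 ≤ θ) (hθ1 : θ < 1) (hφ0 : ∀ a, 0 ≤ φ a) (hφ : Tendsto φ atTop (𝓝 0)) (hδ0 : ∀ K, 0 ≤ δ K)
    (hδ : ∀ K, δ K ≤ C * ∑ j ∈ Finset.range (K + 1), μ K j * θ ^ j) (hμ : ∀ K, ∀ j ≤ K, μ K j ≤ φ (K - j)) :
    Tendsto δ atTop (𝓝 0) := by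
  have hmaj : ∀ K, δ K ≤ C * ageConv φ θ K := fun K =>
    (hδ K).trans (mul_le_mul_of_nonneg_left (sum_range_le_ageConv hθ0 K (hμ K)) hC)
  have hlim : Tendsto (fun K => C * ageConv φ θ K) atTop (𝓝 0) := by
    simpa using (tendsto_ageConv_of_tendsto hφ0 hφ hθ0 hθ1).const_mul C
  exact squeeze_zero hδ0 hmaj hlim

end AllAges

end Summit.QuantumFields.BalabanUV.T4Continuum.NE7PairwiseFixedWindowCensus

end
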